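import Literature.ModelTheory.FiniteModelTheory.PPGadgetSystem
import Literature.Computability.Complexity.CodeFPFinite
import Literature.Computability.Complexity.CodeFPStrings
import HarnessLib

/-!
# Gadget replacement on codes: the numeric program and its typed polynomial time

Topic `Literature/ModelTheory/FiniteModelTheory`; support file for the discharge of
`cspLanguage_karpReducible_of_ppConstructs` (`PPInterpretation.lean`; Barto–Opršal–Pinsker, *The
wonderland of reflections* [BartoOprsalPinsker2017], Prop. 3.1 / Cor. 3.5 — "`CSP(𝔹)` is log-space
reducible to `CSP(𝔸)`"; the tree has polynomial-time Karp reductions `≤ₚ`, the weaker consequence).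
The reduction acts on the CODES of table instances (`encodingSNPInstance`: the binary numeral of the
universe size `n` paired with the `Σₛ n^{arity s}` table bits). This file writes the instance map of
gadget replacement (`PPGadgetSystem.lean`: variables `(Fin n × Fin d) ⊕ Σ i, Fin eᵢ`, placements
`sysLoc`, tuples on representatives) as a functional program over naturals and lists, and proves
each stage typed polynomial time in the `CodeFP` algebra (`Complexity/CodeFP*.lean`, with the string
and sum combinators of `CodeFPStrings.lean`; no machine is written):

* numeric tables of the fixed pp-power `P`: `esN` (number of `∃`-variables of the pp-definition of
  symbol `s`), `eqsN` (its equality atoms), `relsN` (its relational atoms: symbol index and variable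
  positions) — finite lookup tables on codes (`CodeFP.ofList`);
* reading an instance: `blockOff br n s = Σ_{s'<s} n^{arity s'}` (the table offsets, twin of
  `LFPCode.boff`), `conAt`/`conNum` (the list of holding constraints `(s, t)`, `t` the number of the
  scope, read off the table string), `instOK` (well-formedness of an instance code);
* the expansion: `locN` (placement of gadget variable `p` of constraint `(s, t)` as a number:
  copy `j` of element `x` is `j + d·x`, the `j`-th fresh variable of the `i`-th listed constraint is
  `n·d + preN i + j`), `preN`/`nvarN` (block offsets and the number `N'` of variables), `edgesN`
  (the equality atoms placed), `factsN` (the relational atoms placed and relabelled by a given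
  list of labels), `digits`/`bitsAt`/`bitsN` (tabulation of the facts as the table string of the
  image instance);
* their `CodeFP` lemmas (`codeFP_conNum`, `codeFP_edgesN`, `codeFP_factsN`, `codeFP_bitsN`,
  `codeFP_instOK`, …), the universe size carried in unary as the budget of every loop.

The labels themselves (least elements of the classes generated by `edgesN`) come from
`Complexity/CodeFPClosure.lean`; the identification of these numbers with the typed objects of
`PPGadgetSystem.lean` and the assembly of the reduction are in `PPInterpretationProofs.lean`.

## References

* L. Barto, J. Opršal, M. Pinsker, *The wonderland of reflections*, Israel J. Math. 223 (2018)
  = arXiv:1510.04521, Prop. 3.1, Cor. 3.5. [BartoOprsalPinsker2017]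
* S. Arora, B. Barak, *Computational Complexity: A Modern Approach*, CUP 2009, §1.3 (polynomial
  time is closed under composition and polynomially bounded loops), §0.1 (codes). [AroraBarak2009]
-/

namespace Literature.ModelTheory.FiniteModelTheory

open _root_.Computability Literature.Computability.Complexity Literature.Computability.Complexity.CodeFP
  Literature.Computability.Complexity.Brick Literature.Computability.Cryptography Polynomial

namespace GadgetCode

/-! ### The fixed data of the pp-power as numeric tables -/

variable {ar br : List ℕ} {d : ℕ} (P : PPPower (relLanguage ar) (relLanguage br) d)

/-- The number of `∃`-variables of the pp-definition of symbol `s` (`0` off range).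
[cite: BartoOprsalPinsker2017, Def. 3.6] -/
def esN (s : ℕ) : ℕ := if h : s < br.length then P.nEx ⟨s, h⟩ else 0

/-- The equality atoms of the pp-definition of symbol `s`, as pairs of variable positions.
[cite: BartoOprsalPinsker2017, §2.2] -/
def eqsN (s : ℕ) : List (ℕ × ℕ) :=
  if h : s < br.length then (P.fmla ⟨s, h⟩).eqs.map fun e => ((e.1 : ℕ), (e.2 : ℕ)) else []

/-- The relational atoms of the pp-definition of symbol `s`: index of the relation symbol of the
template vocabulary `ar` and the list of variable positions. [cite: BartoOprsalPinsker2017, §2.2] -/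
def relsN (s : ℕ) : List (ℕ × List ℕ) :=
  if h : s < br.length then
    (P.fmla ⟨s, h⟩).rels.map fun a => ((a.2.1.1 : ℕ), List.ofFn fun j => (a.2.2 j : ℕ))
  else []

/-- `esN` off range. [folklore] -/
theorem esN_of_not_lt {s : ℕ} (h : ¬ s < br.length) : esN P s = 0 := by rw [esN, dif_neg h]

/-- `esN` is a finite table on codes (output in unary). [cite: AroraBarak2009, §1.3] -/
theorem codeFP_esN : CodeFP natE unE (esN P) :=
  (ofList natE_injective unE (esN P) 0 (List.range br.length)).congr fun s => by
    by_cases h : s < br.length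
    · rw [if_pos (List.mem_range.2 h)]
    · rw [if_neg (mt List.mem_range.1 h), esN_of_not_lt P h]

/-- `eqsN` is a finite table on codes (positions in unary). [cite: AroraBarak2009, §1.3] -/
theorem codeFP_eqsN : CodeFP natE (rawE (pairE unE unE)) (eqsN P) :=
  (ofList natE_injective (rawE (pairE unE unE)) (eqsN P) [] (List.range br.length)).congr fun s => by
    by_cases h : s < br.length
    · rw [if_pos (List.mem_range.2 h)]
    · rw [if_neg (mt List.mem_range.1 h), eqsN, dif_neg h]

/-- `relsN` is a finite table on codes (positions in unary). [cite: AroraBarak2009, §1.3] -/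
theorem codeFP_relsN : CodeFP natE (rawE (pairE natE (rawE unE))) (relsN P) :=
  (ofList natE_injective (rawE (pairE natE (rawE unE))) (relsN P) [] (List.range br.length)).congr
    fun s => by
      by_cases h : s < br.length
      · rw [if_pos (List.mem_range.2 h)]
      · rw [if_neg (mt List.mem_range.1 h), relsN, dif_neg h]

/-! ### Reading the constraints off the table string -/

/-- The OFFSET of table `s` in the table string of an `n`-element instance: `Σ_{s'<s} n^{arity s'}`
(twin of `LFPCode.boff`; also meaningful at `s = |br|`, the total number of table bits).
[cite: AroraBarak2009, §0.1] -/
def blockOff (br : List ℕ) (n : ℕ) : ℕ → ℕ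
  | 0 => 0
  | s + 1 => blockOff br n s + n ^ br.getD s 0

/-- `blockOff` as the `Fin`-indexed sum of `finSigmaFinEquiv_apply`. [folklore] -/
theorem blockOff_eq_sum (n s : ℕ) (hs : s ≤ br.length) :
    blockOff br n s = ∑ s' : Fin s, n ^ br.get (Fin.castLE hs s') := by
  induction s with
  | zero => simp [blockOff]
  | succ s ih =>
    rw [blockOff, ih (by omega), Fin.sum_univ_castSucc]
    congr 1
    rw [List.getD_eq_getElem _ _ (by omega)]
    rfl

/-- The total number of table bits is `tableBits`. [folklore] -/
theorem blockOff_length (n : ℕ) : blockOff br n br.length = tableBits br n := by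
  rw [blockOff_eq_sum n _ le_rfl, tableBits]
  rfl

/-- `blockOff` on codes (base in binary). [cite: AroraBarak2009, §1.3] -/
theorem codeFP_blockOff : ∀ s : ℕ, CodeFP natE natE (fun n => blockOff br n s)
  | 0 => (const natE 0).congr fun _ => rfl
  | s + 1 => (natAdd.comp ((codeFP_blockOff s).pair
      (natPow.comp ((CodeFP.id natE).pair (const natE (br.getD s 0)))))).congr fun _ => rfl

/-- The holding constraints of symbol `s` read off the table string `body`: the pairs `(s, t)`,
`t < n^{arity s}`, whose bit `blockOff s + t` is set. [cite: BartoOprsalPinsker2017, §2.2] -/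
def conAt (br : List ℕ) (n : ℕ) (body : List Bool) (s : ℕ) : List (ℕ × ℕ) :=
  ((List.range (n ^ br.getD s 0)).filter fun t => body.getD (blockOff br n s + t) false).map
    fun t => (s, t)

/-- All holding constraints, symbol by symbol. [cite: BartoOprsalPinsker2017, §2.2] -/
def conNum (br : List ℕ) (n : ℕ) (body : List Bool) : List (ℕ × ℕ) :=
  (List.range br.length).flatMap fun s => conAt br n body s

/-- `conAt` on codes (`n` in unary, the budget of the loop over `t < n^{arity s}`).
[cite: AroraBarak2009, §1.3] -/
theorem codeFP_conAt (s : ℕ) :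
    CodeFP (pairE unE strE) (rawE (pairE natE natE)) (fun p => conAt br p.1 p.2 s) := by
  let cE : ℕ × List Bool → List Bool := pairE unE strE
  have hrange : CodeFP cE (rawE natE) (fun p => List.range (p.1 ^ br.getD s 0)) :=
    (urange.comp ((ulength unitE).comp ((unitsPow (br.getD s 0)).comp (fst _ _)))).congr fun p => by
      simp
  have hoff : CodeFP cE natE (fun p => blockOff br p.1 s) :=
    (codeFP_blockOff s).comp (natOfUn.comp (fst _ _))
  have hbit : CodeFP (pairE cE natE) bitE (fun q => q.1.2.getD (blockOff br q.1.1 s + q.2) false) :=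
    strGetDNat.comp ((fst _ _).snd'.pair (natAdd.comp ((hoff.comp (fst _ _)).pair (snd _ _))))
  have hfilt : CodeFP cE (rawE natE) (fun p =>
      (List.range (p.1 ^ br.getD s 0)).filter fun t => p.2.getD (blockOff br p.1 s + t) false) :=
    ((filter hbit).comp ((CodeFP.id cE).pair hrange)).congr fun p => rfl
  have hmk : CodeFP (pairE cE natE) (pairE natE natE) (fun q => (s, q.2)) := (const _ s).pair (snd _ _)
  exact ((map hmk).comp ((CodeFP.id cE).pair hfilt)).congr fun p => rfl

/-- `conNum` on codes, by a finite concatenation over the symbols. [cite: AroraBarak2009, §1.3] -/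
theorem codeFP_flatMap_conAt : ∀ l : List ℕ,
    CodeFP (pairE unE strE) (rawE (pairE natE natE)) (fun p => l.flatMap fun s => conAt br p.1 p.2 s)
  | [] => (const _ []).congr fun _ => rfl
  | s :: l => ((rawAppend _).comp ((codeFP_conAt s).pair (codeFP_flatMap_conAt l))).congr fun p => by
      rw [List.flatMap_cons]

/-- **The constraint list of an instance is computed on codes.** [cite: AroraBarak2009, §1.3] -/
theorem codeFP_conNum : CodeFP (pairE unE strE) (rawE (pairE natE natE)) (fun p => conNum br p.1 p.2) :=
  codeFP_flatMap_conAt _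

/-! ### The gadget expansion -/

/-- PLACEMENT, as a number, of variable `p < kd + e` of the gadget of the constraint `c = (s, t)`
whose block of fresh variables starts at `base`: the free variable `j + d a` is copy `j` of the
`a`-th element `t / n^a % n` of the scope, i.e. the number `j + d · (t / n^a % n)`; the quantified
variable `kd + j` is `base + j`. [cite: BartoOprsalPinsker2017, Prop. 3.1 (proof)] -/
def locN (br : List ℕ) (d n : ℕ) (c : ℕ × ℕ) (base p : ℕ) : ℕ :=
  if p < br.getD c.1 0 * d then p % d + d * (c.2 / n ^ (p / d) % n)
  else base + (p - br.getD c.1 0 * d)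

/-- `locN` on codes (record `((1ⁿ, c), (base, 1ᵖ))`). [cite: AroraBarak2009, §1.3] -/
theorem codeFP_locN : CodeFP (pairE (pairE unE (pairE natE natE)) (pairE natE unE)) natE
    (fun q => locN br d q.1.1 q.1.2 q.2.1 q.2.2) := by
  let cE : (ℕ × (ℕ × ℕ)) × (ℕ × ℕ) → List Bool := pairE (pairE unE (pairE natE natE)) (pairE natE unE)
  have hn : CodeFP cE natE (fun q => q.1.1) := natOfUn.comp (fst _ _).fst'
  have hc1 : CodeFP cE natE (fun q => q.1.2.1) := (fst _ _).snd'.fst'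
  have hc2 : CodeFP cE natE (fun q => q.1.2.2) := (fst _ _).snd'.snd'
  have hbase : CodeFP cE natE (fun q => q.2.1) := (snd _ _).fst'
  have hpU : CodeFP cE unE (fun q => q.2.2) := (snd _ _).snd'
  have hp : CodeFP cE natE (fun q => q.2.2) := natOfUn.comp hpU
  have hk : CodeFP cE natE (fun q => br.getD q.1.2.1 0) :=
    (rawGetD natE (d := 0) rfl).comp ((const cE br).pair hc1)
  have hkd : CodeFP cE natE (fun q => br.getD q.1.2.1 0 * d) := natMul.comp (hk.pair (const cE d))
  have htest : CodeFP cE bitE (fun q => decide (q.2.2 < br.getD q.1.2.1 0 * d)) := natLt.comp (hp.pair hkd)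
  have hpd : CodeFP cE natE (fun q => q.2.2 / d) := natDiv.comp (hp.pair (const cE d))
  have hpdU : CodeFP cE unE (fun q => q.2.2 / d) :=
    (unOfNatMin.comp (hpU.pair hpd)).congr fun q => min_eq_left (Nat.div_le_self _ _)
  have hpow : CodeFP cE natE (fun q => q.1.1 ^ (q.2.2 / d)) := natPow.comp (hn.pair hpdU)
  have hdig : CodeFP cE natE (fun q => q.1.2.2 / q.1.1 ^ (q.2.2 / d) % q.1.1) :=
    natMod.comp ((natDiv.comp (hc2.pair hpow)).pair hn)
  have hthen : CodeFP cE natE (fun q => q.2.2 % d + d * (q.1.2.2 / q.1.1 ^ (q.2.2 / d) % q.1.1)) :=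
    natAdd.comp ((natMod.comp (hp.pair (const cE d))).pair (natMul.comp ((const cE d).pair hdig)))
  have helse : CodeFP cE natE (fun q => q.2.1 + (q.2.2 - br.getD q.1.2.1 0 * d)) :=
    natAdd.comp (hbase.pair (natSub.comp (hp.pair hkd)))
  exact (htest.ite hthen helse).congr fun q => by simp only [locN, decide_eq_true_eq]

/-- The total size of the blocks of fresh variables of the first `i` listed constraints.
[cite: BartoOprsalPinsker2017, Prop. 3.1 (proof)] -/
def preN (C : List (ℕ × ℕ)) (i : ℕ) : ℕ := ((C.take i).map fun c => esN P c.1).sum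

/-- The number of variables of the gadget system: `n · d + Σᵢ e_{sᵢ}`.
[cite: BartoOprsalPinsker2017, Prop. 3.1 (proof)] -/
def nvarN (n : ℕ) (C : List (ℕ × ℕ)) : ℕ := n * d + (C.map fun c => esN P c.1).sum

/-- `nvarN` is the offset past the last block. [folklore] -/
theorem nvarN_eq (n : ℕ) (C : List (ℕ × ℕ)) : nvarN P n C = n * d + preN P C C.length := by
  rw [nvarN, preN, List.take_length]

/-- `preN` on codes (binary). [cite: AroraBarak2009, §1.3] -/
theorem codeFP_preN : CodeFP (pairE (rawE (pairE natE natE)) natE) natE (fun p => preN P p.1 p.2) := by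
  have hitem : CodeFP (pairE natE natE) natE (fun c => esN P c.1) :=
    (natOfUn.comp ((codeFP_esN P).comp (fst _ _))).congr fun _ => id_eq _
  have htake : CodeFP (pairE (rawE (pairE natE natE)) natE) (rawE (pairE natE natE)) (fun p => p.1.take p.2) :=
    ((rawTakeUn _).comp ((unOfNatMin.comp (((ulength _).comp (fst _ _)).pair (snd _ _))).pair (fst _ _))).congr
      fun p => by
        obtain ⟨C, i⟩ := p
        show C.take (min i C.length) = C.take i
        rcases le_total i C.length with h | h
        · rw [min_eq_left h]
        · rw [min_eq_right h, List.take_length, List.take_of_length_le h]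
  exact (natSum.comp ((map₀ hitem).comp htake)).congr fun p => rfl

/-- `nvarN` on codes, in UNARY (the budget of the loops over the variables). [cite: AroraBarak2009, §1.3] -/
theorem codeFP_nvarN_un : CodeFP (pairE unE (rawE (pairE natE natE))) unE (fun p => nvarN P p.1 p.2) := by
  have hitem : CodeFP (pairE natE natE) unE (fun c => esN P c.1) := (codeFP_esN P).comp (fst _ _)
  have hsum : CodeFP (pairE unE (rawE (pairE natE natE))) unE (fun p => (p.2.map fun c => esN P c.1).sum) :=
    unSum.comp ((map₀ hitem).comp (snd _ _))
  exact (unAdd.comp ((((unMulConst d).comp (fst _ _))).pair hsum)).congr fun p => by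
    simp only [nvarN]; ring

/-- `nvarN` on codes, in binary. [cite: AroraBarak2009, §1.3] -/
theorem codeFP_nvarN : CodeFP (pairE unE (rawE (pairE natE natE))) natE (fun p => nvarN P p.1 p.2) :=
  (natOfUn.comp (codeFP_nvarN_un P)).congr fun _ => id_eq _

/-- A listed constraint with its position, and the start of its block, on codes: in the context
`(1ⁿ, C)` the item `(i, c)` is sent to `((1ⁿ, c), n d + preN C i)`. [cite: AroraBarak2009, §1.3] -/
theorem codeFP_item : CodeFP (pairE (pairE unE (rawE (pairE natE natE))) (pairE natE (pairE natE natE)))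
    (pairE (pairE unE (pairE natE natE)) natE)
    (fun t => ((t.1.1, t.2.2), t.1.1 * d + preN P t.1.2 t.2.1)) := by
  let cE : (ℕ × List (ℕ × ℕ)) × (ℕ × (ℕ × ℕ)) → List Bool :=
    pairE (pairE unE (rawE (pairE natE natE))) (pairE natE (pairE natE natE))
  have hn : CodeFP cE unE (fun t => t.1.1) := (fst _ _).fst'
  have hnN : CodeFP cE natE (fun t => t.1.1) := (natOfUn.comp hn).congr fun _ => id_eq _
  have hC : CodeFP cE (rawE (pairE natE natE)) (fun t => t.1.2) := (fst _ _).snd'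
  have hi : CodeFP cE natE (fun t => t.2.1) := (snd _ _).fst'
  have hc : CodeFP cE (pairE natE natE) (fun t => t.2.2) := (snd _ _).snd'
  have hbase : CodeFP cE natE (fun t => t.1.1 * d + preN P t.1.2 t.2.1) :=
    natAdd.comp ((natMul.comp (hnN.pair (const cE d))).pair ((codeFP_preN P).comp (hC.pair hi)))
  exact (hn.pair hc).pair hbase

/-- The EDGES of the gadget system as numbers: the placed sides of every equality atom of every
listed constraint (listed with its position `i`, which fixes the start `n d + preN i` of its block).
[cite: BartoOprsalPinsker2017, Prop. 3.1 (proof)] -/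
def edgesN (n : ℕ) (C : List (ℕ × ℕ)) : List (ℕ × ℕ) :=
  ((List.range C.length).zip C).flatMap fun q =>
    (eqsN P q.2.1).map fun e =>
      (locN br d n q.2 (n * d + preN P C q.1) e.1, locN br d n q.2 (n * d + preN P C q.1) e.2)

/-- **The edge list is computed on codes.** [cite: AroraBarak2009, §1.3] -/
theorem codeFP_edgesN : CodeFP (pairE unE (rawE (pairE natE natE))) (rawE (pairE natE natE))
    (fun p => edgesN P p.1 p.2) := by
  let cE : ℕ × List (ℕ × ℕ) → List Bool := pairE unE (rawE (pairE natE natE))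
  -- context of the inner map: `((1ⁿ, c), base)`; item: an equality atom `(1ᵖ, 1^q)`
  let iE : (ℕ × (ℕ × ℕ)) × ℕ → List Bool := pairE (pairE unE (pairE natE natE)) natE
  have hloc1 : CodeFP (pairE iE (pairE unE unE)) natE (fun t => locN br d t.1.1.1 t.1.1.2 t.1.2 t.2.1) :=
    codeFP_locN.comp ((fst _ _).fst'.pair ((fst _ _).snd'.pair (snd _ _).fst'))
  have hloc2 : CodeFP (pairE iE (pairE unE unE)) natE (fun t => locN br d t.1.1.1 t.1.1.2 t.1.2 t.2.2) :=
    codeFP_locN.comp ((fst _ _).fst'.pair ((fst _ _).snd'.pair (snd _ _).snd'))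
  have hinner : CodeFP iE (rawE (pairE natE natE)) (fun c => (eqsN P c.1.2.1).map fun e =>
      (locN br d c.1.1 c.1.2 c.2 e.1, locN br d c.1.1 c.1.2 c.2 e.2)) :=
    ((map (hloc1.pair hloc2)).comp ((CodeFP.id iE).pair ((codeFP_eqsN P).comp (fst _ _).snd'.fst'))).congr
      fun c => rfl
  have houter : CodeFP (pairE cE (pairE natE (pairE natE natE))) (rawE (pairE natE natE)) (fun t =>
      (eqsN P t.2.2.1).map fun e =>
        (locN br d t.1.1 t.2.2 (t.1.1 * d + preN P t.1.2 t.2.1) e.1,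
          locN br d t.1.1 t.2.2 (t.1.1 * d + preN P t.1.2 t.2.1) e.2)) :=
    (hinner.comp (codeFP_item P)).congr fun t => rfl
  have henum : CodeFP cE (rawE (pairE natE (pairE natE natE))) (fun p => (List.range p.2.length).zip p.2) :=
    (rawEnum _).comp (snd _ _)
  exact ((CodeFP.flatten _).comp ((map houter).comp ((CodeFP.id cE).pair henum))).congr fun p => by
    rw [edgesN, List.flatMap_def]
    rfl

/-- The FACTS of the image instance as numbers: every relational atom of every listed constraint,
placed and relabelled by the list of labels `Lab` (junk `0` past its end).
[cite: BartoOprsalPinsker2017, Prop. 3.1 (proof)] -/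
def factsN (n : ℕ) (C : List (ℕ × ℕ)) (Lab : List ℕ) : List (ℕ × List ℕ) :=
  ((List.range C.length).zip C).flatMap fun q =>
    (relsN P q.2.1).map fun a =>
      (a.1, a.2.map fun p => Lab.getD (locN br d n q.2 (n * d + preN P C q.1) p) 0)

/-- **The fact list is computed on codes** (record `(Lab, (1ⁿ, C))`). [cite: AroraBarak2009, §1.3] -/
theorem codeFP_factsN : CodeFP (pairE (rawE natE) (pairE unE (rawE (pairE natE natE))))
    (rawE (pairE natE (rawE natE))) (fun p => factsN P p.2.1 p.2.2 p.1) := by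
  let cE : List ℕ × (ℕ × List (ℕ × ℕ)) → List Bool := pairE (rawE natE) (pairE unE (rawE (pairE natE natE)))
  -- context of the atom map: `(Lab, ((1ⁿ, c), base))`
  let aE : List ℕ × ((ℕ × (ℕ × ℕ)) × ℕ) → List Bool :=
    pairE (rawE natE) (pairE (pairE unE (pairE natE natE)) natE)
  -- innermost: one position `1ᵖ` in context `aE`
  have hlab : CodeFP (pairE aE unE) natE (fun t =>
      t.1.1.getD (locN br d t.1.2.1.1 t.1.2.1.2 t.1.2.2 t.2) 0) :=
    (rawGetD natE (d := 0) rfl).comp ((fst _ _).fst'.pair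
      (codeFP_locN.comp (((fst _ _).snd'.fst'.pair (((fst _ _).snd'.snd').pair (snd _ _))))))
  -- one atom `(r, positions)` in context `aE`
  have hatom : CodeFP (pairE aE (pairE natE (rawE unE))) (pairE natE (rawE natE)) (fun t =>
      (t.2.1, t.2.2.map fun p => t.1.1.getD (locN br d t.1.2.1.1 t.1.2.1.2 t.1.2.2 p) 0)) :=
    (snd _ _).fst'.pair (((map hlab).comp ((fst _ _).pair (snd _ _).snd')).congr fun t => rfl)
  -- all atoms of one listed constraint
  have hcon : CodeFP aE (rawE (pairE natE (rawE natE))) (fun c => (relsN P c.2.1.2.1).map fun a =>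
      (a.1, a.2.map fun p => c.1.getD (locN br d c.2.1.1 c.2.1.2 c.2.2 p) 0)) :=
    ((map hatom).comp ((CodeFP.id aE).pair ((codeFP_relsN P).comp (snd _ _).fst'.snd'.fst'))).congr
      fun c => rfl
  -- in the context `(Lab, (1ⁿ, C))`, the item `(i, c)`
  have houter : CodeFP (pairE cE (pairE natE (pairE natE natE))) (rawE (pairE natE (rawE natE))) (fun t =>
      (relsN P t.2.2.1).map fun a =>
        (a.1, a.2.map fun p => t.1.1.getD
          (locN br d t.1.2.1 t.2.2 (t.1.2.1 * d + preN P t.1.2.2 t.2.1) p) 0)) :=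
    (hcon.comp ((fst _ _).fst'.pair ((codeFP_item P).comp ((fst _ _).snd'.pair (snd _ _))))).congr
      fun t => rfl
  have henum : CodeFP cE (rawE (pairE natE (pairE natE natE))) (fun p => (List.range p.2.2.length).zip p.2.2) :=
    (rawEnum _).comp (snd _ _).snd'
  exact ((CodeFP.flatten _).comp ((map houter).comp ((CodeFP.id cE).pair henum))).congr fun p => by
    rw [factsN, List.flatMap_def]
    rfl

/-! ### Tabulating the image instance -/

/-- The scope numbered `t` over a universe of size `N`: digit `a` in base `N`, `a < l`
(`finFunctionFinEquiv⁻¹` as a list). [folklore] -/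
def digits (N l t : ℕ) : List ℕ := (List.range l).map fun a => t / N ^ a % N

/-- `digits` on codes, for a fixed arity (record `(N, t)` in binary). [cite: AroraBarak2009, §1.3] -/
theorem codeFP_digits (l : ℕ) : CodeFP (pairE natE natE) (rawE natE) (fun p => digits p.1 l p.2) := by
  have hitem : CodeFP (pairE (pairE natE natE) unE) natE (fun q => q.1.2 / q.1.1 ^ q.2 % q.1.1) :=
    natMod.comp ((natDiv.comp ((fst _ _).snd'.pair (natPow.comp ((fst _ _).fst'.pair (snd _ _))))).pair
      (fst _ _).fst')
  exact ((map hitem).comp ((CodeFP.id _).pair (const _ (List.range l)))).congr fun p => rfl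

/-- The table of symbol `r` of the image instance, as bits: scope `t < N^{arity r}` is set iff
`(r, digits t)` is a fact. [cite: BartoOprsalPinsker2017, Prop. 3.1 (proof)] -/
def bitsAt (ar : List ℕ) (N : ℕ) (F : List (ℕ × List ℕ)) (r : ℕ) : List Bool :=
  (List.range (N ^ ar.getD r 0)).map fun t => decide ((r, digits N (ar.getD r 0) t) ∈ F)

/-- The table string of the image instance. [cite: BartoOprsalPinsker2017, Prop. 3.1 (proof)] -/
def bitsN (ar : List ℕ) (N : ℕ) (F : List (ℕ × List ℕ)) : List Bool :=
  (List.range ar.length).flatMap fun r => bitsAt ar N F r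

/-- `bitsAt` on codes (record `(1ᴺ, F)`). [cite: AroraBarak2009, §1.3] -/
theorem codeFP_bitsAt (r : ℕ) :
    CodeFP (pairE unE (rawE (pairE natE (rawE natE)))) (rawE bitE) (fun p => bitsAt ar p.1 p.2 r) := by
  let cE : ℕ × List (ℕ × List ℕ) → List Bool := pairE unE (rawE (pairE natE (rawE natE)))
  have hrange : CodeFP cE (rawE natE) (fun p => List.range (p.1 ^ ar.getD r 0)) :=
    (urange.comp ((ulength unitE).comp ((unitsPow (ar.getD r 0)).comp (fst _ _)))).congr fun p => by
      simp
  have hkey : CodeFP (pairE cE natE) (pairE natE (rawE natE)) (fun q => (r, digits q.1.1 (ar.getD r 0) q.2)) :=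
    (const _ r).pair ((codeFP_digits (ar.getD r 0)).comp ((natOfUn.comp (fst _ _).fst').pair (snd _ _)))
  have hmem : CodeFP (pairE cE natE) bitE (fun q => decide ((r, digits q.1.1 (ar.getD r 0) q.2) ∈ q.1.2)) :=
    (mem (pairE_injective natE_injective (rawE_injective natE_injective))).comp (hkey.pair (fst _ _).snd')
  exact ((map hmem).comp ((CodeFP.id cE).pair hrange)).congr fun p => rfl

/-- `bitsN` on codes, by a finite concatenation over the symbols. [cite: AroraBarak2009, §1.3] -/
theorem codeFP_flatMap_bitsAt : ∀ l : List ℕ,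
    CodeFP (pairE unE (rawE (pairE natE (rawE natE)))) (rawE bitE) (fun p => l.flatMap fun r => bitsAt ar p.1 p.2 r)
  | [] => (const _ []).congr fun _ => rfl
  | r :: l => ((rawAppend _).comp ((codeFP_bitsAt r).pair (codeFP_flatMap_bitsAt l))).congr fun p => by
      rw [List.flatMap_cons]

/-- **The table string of the image instance is computed on codes** (as a bit string).
[cite: AroraBarak2009, §1.3] -/
theorem codeFP_bitsN : CodeFP (pairE unE (rawE (pairE natE (rawE natE)))) strE (fun p => bitsN ar p.1 p.2) :=
  (bitsToStr.comp (codeFP_flatMap_bitsAt _)).congr fun _ => rfl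

/-! ### Well-formed instance codes -/

/-- THE WELL-FORMEDNESS TEST of an instance code over `br`: the string re-pairs from its decoded
header numeral `n` and its body, and the body has the `tableBits br n` bits of a table string
(twin of `KSatSNP.instOK` for an arbitrary vocabulary). [folklore] -/
def instOK (br : List ℕ) (w : List Bool) : Bool :=
  decide (boolPair (encodeNat (bitsToNat (fstF w))) (sndF w) = w) &&
    decide ((sndF w).length = blockOff br (bitsToNat (fstF w)) br.length)

/-- `instOK` is computed on codes. [cite: AroraBarak2009, §1.3] -/
theorem codeFP_instOK : CodeFP strE bitE (instOK br) := by
  have h1 : CodeFP strE bitE (fun w => decide (boolPair (encodeNat (bitsToNat (fstF w))) (sndF w) = w)) :=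
    (CodeFP.eq (eα := strE) fun _ _ h => h).comp
      ((codeFP_hdrBody.recodeOut (eγ := strE) fun w => rfl).pair (CodeFP.id strE))
  have h2 : CodeFP strE bitE (fun w => decide ((sndF w).length = blockOff br (bitsToNat (fstF w)) br.length)) :=
    natEq.comp ((strNatLength.comp codeFP_hdrBody.snd').pair ((codeFP_blockOff br.length).comp codeFP_hdrBody.fst'))
  exact (h1.and h2).congr fun w => rfl

end GadgetCode

end Literature.ModelTheory.FiniteModelTheory
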